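import Summits.BirchSwinnertonDyer.Rank1Residual.Additive.CensusX42Bridges
import HarnessLib

/-!
# Census relation X4-2 AT WINDOW GRADE: the VALUATION shadow `CensusX42.ValRelationAt W p Dh`
# (cell `b2b-bsdres`, census cell `bsd-formula-census`, seat `b2b-bsdres-census-ctyper1` =
# conjecture-typer 1, gen 6; the typed form of W2's X4-2 WINDOW relation `v_p(A′) = v_p(h) + v_p(C)`,
# X42-WINDOW.md sha256 `a10a170979128fde17cf31b1704581a6d978f587434da820ed86243fc49ef835`)

HONEST FRAMING (cell `b2b-bsdres`, run/shared/lean/b2b/bsd-rank1-residual/, verbatim in every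
file): the goal of the cell is to DELETE the COMBINATION-SHAPED residual classes of the
Birch–Swinnerton-Dyer formula for ALL analytic-rank `≤ 1` elliptic curves over `ℚ` — "full BSD
formula for every rank `≤ 1` curve in class `C`" assembled STRICTLY from published theorems — so
that the rank-`≤ 1` remainder becomes exactly the CONSTRUCTION-SHAPED classes, which are TYPED
(missing-input `Prop`s), NOT attempted. This is not "finishing BSD". Census cell
(bsd-formula-census): research instrumentation; census output = EVIDENCE / conjecture items, never a
Literature fact; labels / RESIDUAL-MAP marks UNCHANGED (O7-ord OPEN; X3♯ / X4♯ CONSTRUCTION-SHAPED);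
nothing booked. ONE definition (the typed relation, `@[conjecture]`: an obligation node, nothing
asserted) and theorems; no named fact. Named facts enter as HYPOTHESES (`hK`, `hWu`/`hW16`, `hDel` /
`hDel3` / `hDelM`, `hGZ`, `hGZK`, `hmod` / `hmodD`).

## What, and why a second predicate

Gen 2 typed the X4-2 CANDIDATE relation as the EXACT identity `CensusX42.RelationAt W p Dh`
(`CensusX42LeadingTerm.lean`, p252477): on the `ω^{(p−1)/2}`-branch `L` of the semistable twist
`E♭`, `L(0) = 0`, `[T¹]L ≠ 0` and `ϖ·[T¹]L·log_p(γ)·#T² = u·s·Reg_p(E,Dh)·∏c` with the unit PINNED,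
`u = α♭⁻¹` (even) / `α♭⁻¹·c_∞(E)` (odd) / `ã⁻¹(·c_∞)` ((M)) — the blind fit's survivor on the 699
`N ≤ 3000` rows (X42-REPORT.md sha256 `e8592c9a2e1a59c13e754928288c9f6b1ce554f7ffb80b93db3c55aa7f5e9950`).
The X4-2 WINDOW (cp-bsd-w2, `N < 2·10⁴`, 429 rank-one O7-ord pairs: M 287 / Gord3 128 / Gord_e2 14;
`p = 3`: 397, `p = 5`: 32; Engine C review ACCEPT 2026-08-21T10:37Z; label EVIDENCE — per-pair
valuation CERTIFICATES, two engines on each side) measured ONLY THE VALUATION of that identity: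
`v_p(A′) = v_p(h) + v_p(#Ш_an·∏c/#T²)` on 429/429 (and X42-REPORT: 700/700), `A′ ≠ 0`, `L(0) = O(pⁿ)`;
the unit `u` is invisible to it. This file types exactly that — **`ValRelationAt W p Dh`**: same
quantifier frame as `RelationAt` (every twist model `V`, isomorphism `C`, newform `f`, period ratio
`ϖ` of the parity of `(p−1)/2`, census literal `s = #Ш_an`), clauses `L(0) = 0`, `[T¹]L ≠ 0` and
`‖ϖ·[T¹]L·log_p(γ)·#T²‖_p = ‖s·Reg_p(E,Dh)·∏c‖_p` — and proves:

* §2 `valRelationAt_of_relationAt` (exact ⟹ valuation: `‖α♭⁻¹‖ = ‖ã⁻¹‖ = ‖c_∞‖ = 1`);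
* §3 the first bridges FROM THE VALUATION RELATION ALONE: `branchCoeffOneNeZeroAt_of_valRelationAt`
  (additive-p2's weak certificate) and `schneider_of_valRelationAt[_of_twist_model|_mult]`
  (`Reg_p(E,Dh) ≠ 0`: the norm clause with a non-zero left side).
Sibling files (same seat, same gen): `CensusX42ValBridges.lean` — `branchPAdicGrossZagier[∅|Odd|Mult]At_of_valRelationAt`
(p01's three typed branch `p`-adic Gross–Zagier inputs are THEMSELVES "up to a unit `u ∈ ℤ_p^×`"
statements, so the valuation clause suffices) and the `∀ Dh` suppliers
`forall_schneider_and_branchPAdicGrossZagier[∅|Odd|Mult]At_of_forall_valRelationAt` (= the hypothesis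
`hGZ : ∀ Dh, LeadingTermClauses → SchneiderConjecture Dh ∧ BranchPAdicGrossZagier…At W p Dh` of EVERY
rank-one class theorem of team n1011 — p01's IMC-version iffs, p16's (S10), p07 / p12's (M) / X3♯ twins);
`CensusX42ValUnitRows.lean` — the (S10) unit-row nodes at WINDOW grade (`…_of_censusX42Val_of_shaAn_unit`);
`CensusX42ValCoeffValuation.lean` — the KURREG column `vReg_x42(v₁)` at WINDOW grade; `CensusX42ValConverse.lean`
— the CONVERSE: on (G-ord) resp. (M) rows `ValRelationAt W p Dh ↔ SchneiderConjecture Dh ∧` p01's typed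
branch `p`-adic Gross–Zagier of the row (`valRelationAt_iff_schneider_and_branchPAdicGrossZagier[Mult]`), i.e.
the typed WINDOW relation is EXACTLY the kernel's open rank-one input plus the rider.

KERNEL READING (no booking). Every consumer of X4-2 in the tree — this seat's `CensusX42Bridge(s)`,
`CensusX42BSD{,Corollaries,Mult,IMC}`, `CensusX42CoeffValuation`, `CensusX42UnitRows`, and through them
p01 / p07 / p10 / p12 / p16's `hGZ`-shaped theorems — uses `RelationAt` only through `ValRelationAt`:
the pinned unit `α♭⁻¹·c_∞(E)` of the `N ≤ 3000` fit is SURPLUS to all of them. Consequently the 429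
WINDOW pairs, where only valuations were certified, feed the same kernel nodes at their own evidence
grade (per-pair valuation certificate), modulo the one READING the census carries everywhere: the
census height `h` IS `Reg_p(E,Dh)` for a Delbourgo (B)-datum `Dh` (rmap-2 g9 page-read on Gord2:
Delbourgo 2002 pp. 38/67, Mazur–Tate 1983 §(4.4), Mazur–Stein–Tate 2006 (1.1); (M):
MT-mult-height-comparison-unread) — never asserted; `Dh` stays a PARAMETER.

## In print

`ValRelationAt` at a rank-one pair has, clause for clause, the SHAPE of D. Delbourgo's **BS-D(p) Conjecture**
(Compositio Math. 113 (1998) §2.5, pp. 151–152, held text `paper:delbourgo1998-…` p0029–p0030, read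
2026-08-21): "(i) The order of vanishing of `L_p(E,⟨x⟩^s)` should be given by
`order_{s=0} L_p(E,⟨x⟩^s) = r_E`, where `r_E` is the order of the zero of the Hasse–Weil L-series of `E`.
(ii) The leading term of `L_p(E,⟨x⟩^s)` should satisfy the equivalence
`(1/r_E!) d^{r_E}/ds^{r_E} L_p(E,⟨x⟩^s)|_{s=0} ∼ #Ш_E(p)·∏c·Reg_p(E)/#E(ℚ)²_tors`" with `∼`
"denoting equivalence up to a `p`-adic unit" (ibid. Prop. 4, p. 144) and `Reg_p(E) = det⟨P_i,P_j⟩_ℚ`,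
`⟨,⟩_ℚ = [K:ℚ]⁻¹⟨,⟩_K` over a field `K` where `E` becomes semistable above `p` (p. 151; here
`K = ℚ(√p*)`, `[K:ℚ] = 2`, a `p`-adic unit) — AT `r_E = 1`, with `#Ш_E(p)` REPLACED by the
`p`-part of the BSD value `#Ш_an` (so: BS-D(p)(i)(ii) ∘ BSD(E,p)) and `Reg_p(E)` by `Reg_p(E,Dh)`, and
with Delbourgo's `L_p(E,⟨x⟩^s)` REPLACED by the Mazur–Tate–Teitelbaum `ω^{(p−1)/2}`-branch of the twist
`f♭` in PARI's normalisation (dictionary of `CensusX42LeadingTerm`; `d/ds|₀ = log_p(γ)·d/dT|₀`). CAVEAT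
(the cell's open reading, not touched here): that Delbourgo's own `L_p(E,s)` (Compositio 1998 §1.5–1.7,
Thm. 1) agrees with this branch UP TO A `p`-ADIC UNIT is the 'comparison constant' question of
RESIDUAL-MAP O7-ord (n1011's typed `DisegniDelbourgoComparisonAt`); the valuation relation below is
stated for the branch, and only its SHAPE is Delbourgo's. A CONJECTURE-shaped statement, numerically
CERTIFIED per pair by the census (valuation level) — hence `@[conjecture]`, label EVIDENCE; the `#Ш`
exponent is UNDETERMINED by the census (`#Ш_an = 1` on every row of record).
[cite: Delbourgo1998, §2.5 BS-D(p) (i)(ii) (pp. 151–152) (shape; nothing asserted)]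

References: D. Delbourgo, Compositio Math. 113 (1998) §2.5 [Delbourgo1998]; D. Delbourgo, J. Number
Theory 95 (2002) Thm. (A)/(B) [Delbourgo2002]; K. Kato, Astérisque 295 (2004) Thm. 17.4 (3)
[Kato2004Asterisque]; C. Wuthrich, Doc. Math. 19 (2014) Thm. 16 [Wuthrich2014]; B. Gross, D. Zagier,
Invent. Math. 84 (1986) Thm. I.(7.3) [GrossZagier1986]; B. Mazur, J. Tate, J. Teitelbaum, Invent. Math.
84 (1986) §I.10, §I.13 [MazurTateTeitelbaum1986Invent]; P. Schneider, Invent. Math. 69 (1982) §1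
[Schneider1982PadicHeightI]; R. L. Miller, LMS J. Comput. Math. 14 (2011) Def. 1.1 [Miller2011LMS];
census files of record: X42-REPORT.md, X42-WINDOW.md (+ x42/window/X42_window_valuations.tsv sha256
`3a31299352f404150bc3121f576e01cc680e3a1caf74ee5a2edd6424fc01e7b5`), module docstring of
`CensusX42LeadingTerm.lean` (dictionary PARI ↔ tree).
-/

set_option autoImplicit false

noncomputable section

open scoped Classical MatrixGroups ModularForm NumberField

open CongruenceSubgroup WeierstrassCurve NumberField Literature.NumberTheory.EllipticCurves
  Literature.NumberTheory.EllipticCurves.ModularForms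
  Literature.NumberTheory.EllipticCurves.Rank1Residual
  Literature.NumberTheory.EllipticCurves.Rank1Residual.Typed
  Literature.NumberTheory.EllipticCurves.Delbourgo2002
  Literature.NumberTheory.GaloisRepresentations
  Literature.Barriers.BirchSwinnertonDyer
  IsDedekindDomain

namespace Summit.BirchSwinnertonDyer.Rank1Residual.Additive

namespace CensusX42

/-! ### §1 The typed relation at WINDOW grade (valuations only) -/

/-- **Census relation X4-2 at WINDOW grade — the valuation shadow of `RelationAt`** (EVIDENCE:
X42-REPORT `v_p(A′) = v_p(h) + v_p(C)` 700/700, X42-WINDOW 429/429, two engines each side; the unit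
of the exact identity is NOT part of this predicate). Same frame as `RelationAt W p Dh`: WHENEVER
`W = E` (globally minimal) is additive at `p`, `ℚ`-isomorphic by `C` to the twist by `p* = ±p` of a
globally minimal `V = E♭` good or multiplicative at `p` with newform `f`, `ord_{s=1} L(E,s) = 1` and
`#Ш_an(E) = s`, then for every period ratio `ϖ` of the parity of `(p−1)/2` and the corresponding branch
`L` (good ORDINARY `V`: `L_p(f, α♭, ω^{(p−1)/2})`, plus/minus; multiplicative `V`: the one-term branch
with `ã = a_p(V)`): `L(0) = 0`, `[T¹]L ≠ 0`, and
`‖ϖ · [T¹]L · log_p(γ_cyc) · #E(ℚ)²_tors‖_p = ‖s · Reg_p(E,Dh) · ∏_v c_v‖_p`.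
SHAPE in print as a CONJECTURE: Delbourgo 1998 BS-D(p) (i)(ii) at `r_E = 1` ("up to a `p`-adic
unit"), composed with BSD's value of `#Ш` and read on the MTT branch of the twist in PARI's
normalisation (Delbourgo's `L_p(E,s)` ↔ branch comparison up to a unit = the cell's open reading, not
asserted); NOT a theorem ⇒ `@[conjecture]` (obligation node; nothing asserted). `Dh : PAdicHeightData W p`
is a PARAMETER (the census height; READING `h = Reg_p(E,Dh)`, never asserted).
[cite: Delbourgo1998, §2.5 BS-D(p) (i)(ii) (pp. 151–152) (shape only; nothing asserted)]
[cite: MazurTateTeitelbaum1986Invent, §I.10, §I.13] -/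
@[conjecture]
def ValRelationAt (W : WeierstrassCurve ℚ) [W.IsElliptic] [W.IsGloballyMinimal] (p : ℕ) [Fact p.Prime]
    (Dh : PAdicHeightData W p) : Prop :=
  ∀ (V : WeierstrassCurve ℚ) [V.IsElliptic] [V.IsGloballyMinimal] (C : VariableChange ℚ)
    {N : ℕ} [NeZero N] (f : CuspForm (Gamma0 N) 2),
    Addv W p → (Good V p ∨ Mult V p) → IsNewformOf V f → W.analyticRank = 1 →
    ∀ s : ℚ, shaAn W = (s : ℂ) →
    -- rows `p ≡ 1 (mod 4)`: `p* = p`, even branch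
    (p % 4 = 1 → C • V.quadraticTwist (p : ℚ) = W → ∀ ϖ : ℚ,
      (ϖ : ℝ) * V.realPeriodRat = plusPeriod f →
        (IsOrdinaryAt V p →
          PowerSeries.constantCoeff (padicLFunctionBranch f (unitRoot V p : ℚ_[p]) (p / 2)) = 0 ∧
          PowerSeries.coeff 1 (padicLFunctionBranch f (unitRoot V p : ℚ_[p]) (p / 2)) ≠ 0 ∧
          ‖(ϖ : ℚ_[p]) * PowerSeries.coeff 1 (padicLFunctionBranch f (unitRoot V p : ℚ_[p]) (p / 2)) *
              padicLog p (cyclotomicGenerator p) * (W.torsionOrder : ℚ_[p]) ^ 2‖ =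
            ‖(s : ℚ_[p]) * padicRegulator Dh * W.tamagawaProduct‖) ∧
        (Mult V p →
          PowerSeries.constantCoeff
              (padicLFunctionPlusBranchMult f ((V.LFunction p : ℤ) : ℚ_[p]) (p / 2)) = 0 ∧
          PowerSeries.coeff 1 (padicLFunctionPlusBranchMult f ((V.LFunction p : ℤ) : ℚ_[p]) (p / 2)) ≠ 0 ∧
          ‖(ϖ : ℚ_[p]) *
                PowerSeries.coeff 1 (padicLFunctionPlusBranchMult f ((V.LFunction p : ℤ) : ℚ_[p]) (p / 2)) *
              padicLog p (cyclotomicGenerator p) * (W.torsionOrder : ℚ_[p]) ^ 2‖ =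
            ‖(s : ℚ_[p]) * padicRegulator Dh * W.tamagawaProduct‖)) ∧
    -- rows `p ≡ 3 (mod 4)`: `p* = −p`, odd branch
    (p % 4 = 3 → C • V.quadraticTwist (-(p : ℚ)) = W → ∀ ϖ : ℚ,
      (ϖ : ℝ) * V.imaginaryPeriodRat = minusPeriod f →
        (IsOrdinaryAt V p →
          PowerSeries.constantCoeff (padicLFunctionMinusBranch f (unitRoot V p : ℚ_[p]) (p / 2)) = 0 ∧
          PowerSeries.coeff 1 (padicLFunctionMinusBranch f (unitRoot V p : ℚ_[p]) (p / 2)) ≠ 0 ∧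
          ‖(ϖ : ℚ_[p]) * PowerSeries.coeff 1 (padicLFunctionMinusBranch f (unitRoot V p : ℚ_[p]) (p / 2)) *
              padicLog p (cyclotomicGenerator p) * (W.torsionOrder : ℚ_[p]) ^ 2‖ =
            ‖(s : ℚ_[p]) * padicRegulator Dh * W.tamagawaProduct‖) ∧
        (Mult V p →
          PowerSeries.constantCoeff
              (padicLFunctionMinusBranchMult f ((V.LFunction p : ℤ) : ℚ_[p]) (p / 2)) = 0 ∧
          PowerSeries.coeff 1 (padicLFunctionMinusBranchMult f ((V.LFunction p : ℤ) : ℚ_[p]) (p / 2)) ≠ 0 ∧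
          ‖(ϖ : ℚ_[p]) *
                PowerSeries.coeff 1 (padicLFunctionMinusBranchMult f ((V.LFunction p : ℤ) : ℚ_[p]) (p / 2)) *
              padicLog p (cyclotomicGenerator p) * (W.torsionOrder : ℚ_[p]) ^ 2‖ =
            ‖(s : ℚ_[p]) * padicRegulator Dh * W.tamagawaProduct‖))

/-! ### §2 Exact ⟹ valuation -/

variable {p : ℕ} [hp : Fact p.Prime]

omit hp in
/-- A non-zero `p`-adic number of valuation `0` has norm `1`. [folklore] -/
private theorem norm_eq_one_of_val_zero [Fact p.Prime] {t : ℚ_[p]} (h0 : t ≠ 0)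
    (hv : t.valuation = 0) : ‖t‖ = 1 := by
  rw [Padic.norm_eq_zpow_neg_valuation h0, hv, neg_zero, zpow_zero]

omit hp in
/-- Bookkeeping: an exact identity `x = u · y` with `‖u‖ = 1` gives `‖x‖ = ‖y‖`. [folklore] -/
private theorem norm_eq_of_eq_unit_mul [Fact p.Prime] {x u y : ℚ_[p]} (hu : ‖u‖ = 1)
    (h : x = u * y) : ‖x‖ = ‖y‖ := by
  rw [h, norm_mul, hu, one_mul]

/-- **`RelationAt W p Dh ⟹ ValRelationAt W p Dh`** (the pinned unit has norm `1`:
`‖α♭⁻¹‖ = 1` (`unitRoot_inv_ne_zero_and_valuation`), `‖ã⁻¹‖ = 1` (`ã = ±1`), `‖c_∞(E)‖ = 1` (`p` odd)).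
[cite: MazurTateTeitelbaum1986Invent, §I.10, §I.11, §I.13] -/
theorem valRelationAt_of_relationAt {W : WeierstrassCurve ℚ} [W.IsElliptic] [W.IsGloballyMinimal]
    {Dh : PAdicHeightData W p} (h : RelationAt W p Dh) : ValRelationAt W p Dh := by
  intro V _ _ C N _ f hadd hV hf hr s hs
  obtain ⟨heven, hodd⟩ := h V C f hadd hV hf hr s hs
  refine ⟨fun h1 hC ϖ hϖ ↦ ?_, fun h3 hC ϖ hϖ ↦ ?_⟩
  · obtain ⟨hG, hM⟩ := heven h1 hC ϖ hϖ
    refine ⟨fun hord ↦ ?_, fun hmult ↦ ?_⟩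
    · obtain ⟨h0, hne, hid⟩ := hG hord
      obtain ⟨hu0, hu⟩ := unitRoot_inv_ne_zero_and_valuation (p := p) V hord
      exact ⟨h0, hne, norm_eq_of_eq_unit_mul (norm_eq_one_of_val_zero hu0 hu) hid⟩
    · obtain ⟨h0, hne, hid⟩ := hM hmult
      obtain ⟨hu0, hu⟩ := intCast_LFunction_inv_ne_zero_and_valuation (p := p) hf hmult
      exact ⟨h0, hne, norm_eq_of_eq_unit_mul (norm_eq_one_of_val_zero hu0 hu) hid⟩
  · have hp2 : p ≠ 2 := by omega
    obtain ⟨hκ0, hκ⟩ := numRealComponents_cast_ne_zero_and_valuation (p := p) hp2 W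
    have hκ1 := norm_eq_one_of_val_zero hκ0 hκ
    obtain ⟨hG, hM⟩ := hodd h3 hC ϖ hϖ
    refine ⟨fun hord ↦ ?_, fun hmult ↦ ?_⟩
    · obtain ⟨h0, hne, hid⟩ := hG hord
      obtain ⟨hu0, hu⟩ := unitRoot_inv_ne_zero_and_valuation (p := p) V hord
      refine ⟨h0, hne, norm_eq_of_eq_unit_mul (u := ((unitRoot V p : ℤ_[p]) : ℚ_[p])⁻¹ *
        ((W.baseChange ℝ).numRealComponents : ℚ_[p])) ?_ hid⟩
      rw [norm_mul, norm_eq_one_of_val_zero hu0 hu, hκ1, mul_one]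
    · obtain ⟨h0, hne, hid⟩ := hM hmult
      obtain ⟨hu0, hu⟩ := intCast_LFunction_inv_ne_zero_and_valuation (p := p) hf hmult
      refine ⟨h0, hne, norm_eq_of_eq_unit_mul (u := (((V.LFunction p : ℤ)) : ℚ_[p])⁻¹ *
        ((W.baseChange ℝ).numRealComponents : ℚ_[p])) ?_ hid⟩
      rw [norm_mul, norm_eq_one_of_val_zero hu0 hu, hκ1, mul_one]

/-! ### §3 Bridges from the valuation relation alone -/

omit hp in
/-- `‖x‖ = ‖y‖` with `x ≠ 0` exhibits a unit `u ∈ ℤ_p^×` with `x = u·y`. [folklore] -/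
private theorem exists_unit_mul_of_norm_eq [Fact p.Prime] {x y : ℚ_[p]} (hx : x ≠ 0) (h : ‖x‖ = ‖y‖) :
    ∃ u : ℤ_[p]ˣ, x = ((u : ℤ_[p]) : ℚ_[p]) * y := by
  have hy : y ≠ 0 := by
    rintro rfl
    exact hx (norm_eq_zero.mp (by rw [h, norm_zero]))
  have hn : ‖x / y‖ = 1 := by
    rw [norm_div, h, div_self (norm_ne_zero_iff.mpr hy)]
  exact ⟨PadicInt.mkUnits hn, by rw [PadicInt.mkUnits_eq, div_mul_cancel₀ x hy]⟩

omit hp in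
/-- From the norm clause: the left side is non-zero iff the regulator is. [folklore] -/
private theorem padicRegulator_ne_zero_of_norm_eq [Fact p.Prime] {W : WeierstrassCurve ℚ}
    (Dh : PAdicHeightData W p) {x : ℚ_[p]} (hx : x ≠ 0) {s : ℚ}
    (h : ‖x‖ = ‖(s : ℚ_[p]) * padicRegulator Dh * W.tamagawaProduct‖) : padicRegulator Dh ≠ 0 := by
  intro hR
  rw [hR, mul_zero, zero_mul, norm_zero, norm_eq_zero] at h
  exact hx h

/-- The left side `ϖ·c₁·log_p(γ)·#T²` of the clause is non-zero once `c₁ ≠ 0` (`ϖ ≠ 0`,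
`log_p γ_cyc ≠ 0`, `#T ≠ 0`). [folklore] -/
private theorem lhs_ne_zero {W : WeierstrassCurve ℚ} [W.IsElliptic] {ϖ : ℚ} (hϖ0 : (ϖ : ℚ_[p]) ≠ 0)
    {c : ℚ_[p]}
    (hc : c ≠ 0) :
    (ϖ : ℚ_[p]) * c * padicLog p (cyclotomicGenerator p) * (W.torsionOrder : ℚ_[p]) ^ 2 ≠ 0 := by
  have hT : (W.torsionOrder : ℚ_[p]) ^ 2 ≠ 0 :=
    pow_ne_zero 2 (by exact_mod_cast (W.torsionOrder_pos_holds).ne')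
  exact mul_ne_zero (mul_ne_zero (mul_ne_zero hϖ0 hc) (padicLog_cyclotomicGenerator_ne_zero p)) hT

/-- **Valuation relation AT THE PAIR ⟹ additive-p2's weak certificate `BranchCoeffOneNeZeroAt W p`**
(clause `[T¹]L ≠ 0` times `ϖ ≠ 0`). [cite: MazurTateTeitelbaum1986Invent, §I.13] [cite: GrossZagier1986, Thm. I.(7.3)] -/
theorem branchCoeffOneNeZeroAt_of_valRelationAt (hGZ : GrossZagier1986_thm_I_7_3)
    (hGZK : rank_eq_analyticRank_of_analyticRank_le_one) {W : WeierstrassCurve ℚ} [W.IsElliptic]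
    [W.IsGloballyMinimal] (hp2 : p ≠ 2) (hadd : Addv W p) (hr : W.analyticRank = 1)
    {Dh : PAdicHeightData W p} (hrel : ValRelationAt W p Dh) : BranchCoeffOneNeZeroAt W p := by
  intro V _ _ C hC hord N _ f hf ϖ hϖ
  obtain ⟨s, -, hs⟩ := X11b.exists_rat_ne_zero_shaAn_eq_of_analyticRank_eq_one hGZ hGZK W hr
  obtain ⟨heven, hodd⟩ := hrel V C f hadd (Or.inl hord.1) hf hr s hs
  have hϖ0 := periodRatio_ne_zero (p := p) hf hϖ
  have hodd4 : p % 4 = 1 ∨ p % 4 = 3 := by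
    obtain ⟨k, hk⟩ := hp.out.odd_of_ne_two hp2
    omega
  rcases hodd4 with h1 | h3
  · have hev : Even (p / 2) := ⟨p / 4, by omega⟩
    have hC' : C • V.quadraticTwist (p : ℚ) = W := by
      rw [pStar_eq_of_mod_four p (Or.inl h1), if_pos h1] at hC; exact hC
    rw [if_pos hev] at hϖ ⊢
    obtain ⟨-, hne, -⟩ := (heven h1 hC' ϖ hϖ).1 hord
    rw [PowerSeries.coeff_C_mul]
    exact mul_ne_zero hϖ0 hne
  · have hnev : ¬ Even (p / 2) := by rw [Nat.not_even_iff_odd]; exact ⟨p / 4, by omega⟩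
    have hC' : C • V.quadraticTwist (-(p : ℚ)) = W := by
      rw [pStar_eq_of_mod_four p (Or.inr h3), if_neg (by omega)] at hC; exact hC
    rw [if_neg hnev] at hϖ ⊢
    obtain ⟨-, hne, -⟩ := (hodd h3 hC' ϖ hϖ).1 hord
    rw [PowerSeries.coeff_C_mul]
    exact mul_ne_zero hϖ0 hne

/-- **Valuation relation for `Dh` ⟹ `Reg_p(E,Dh) ≠ 0`, pointwise form** (any twist model `V`, good
ordinary or multiplicative at `p`, newform and period ratio at which the relation is instantiated):
the norm clause with a non-zero left side forces a non-zero regulator. [cite: Schneider1982PadicHeightI, §1]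
[cite: MazurTateTeitelbaum1986Invent, §I.10, §I.13] -/
theorem schneider_of_valRelationAt_of_twist_model (hGZ : GrossZagier1986_thm_I_7_3)
    (hGZK : rank_eq_analyticRank_of_analyticRank_le_one) {W : WeierstrassCurve ℚ} [W.IsElliptic]
    [W.IsGloballyMinimal] (hp2 : p ≠ 2) (hadd : Addv W p) (hr : W.analyticRank = 1)
    (V : WeierstrassCurve ℚ) [V.IsElliptic] [V.IsGloballyMinimal] (C : VariableChange ℚ)
    (hC : C • V.quadraticTwist ((-1 : ℚ) ^ (p / 2) * p) = W) (hV : IsOrdinaryAt V p ∨ Mult V p)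
    {N : ℕ} [NeZero N] {f : CuspForm (Gamma0 N) 2} (hf : IsNewformOf V f) (ϖ : ℚ)
    (hϖ : if Even (p / 2) then (ϖ : ℝ) * V.realPeriodRat = plusPeriod f
      else (ϖ : ℝ) * V.imaginaryPeriodRat = minusPeriod f)
    {Dh : PAdicHeightData W p} (hrel : ValRelationAt W p Dh) : SchneiderConjecture Dh := by
  obtain ⟨s, -, hs⟩ := X11b.exists_rat_ne_zero_shaAn_eq_of_analyticRank_eq_one hGZ hGZK W hr
  have hgm : Good V p ∨ Mult V p := hV.imp_left fun h ↦ h.1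
  obtain ⟨heven, hodd⟩ := hrel V C f hadd hgm hf hr s hs
  have hϖ0 : (ϖ : ℚ_[p]) ≠ 0 := periodRatio_ne_zero (p := p) hf hϖ
  have hodd4 : p % 4 = 1 ∨ p % 4 = 3 := by
    obtain ⟨k, hk⟩ := hp.out.odd_of_ne_two hp2
    omega
  rcases hodd4 with h1 | h3
  · have hev : Even (p / 2) := ⟨p / 4, by omega⟩
    have hC' : C • V.quadraticTwist (p : ℚ) = W := by
      rw [pStar_eq_of_mod_four p (Or.inl h1), if_pos h1] at hC; exact hC
    rw [if_pos hev] at hϖ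
    obtain ⟨hG, hM⟩ := heven h1 hC' ϖ hϖ
    rcases hV with hord | hmult
    · obtain ⟨-, hne, hn⟩ := hG hord
      exact padicRegulator_ne_zero_of_norm_eq Dh (lhs_ne_zero hϖ0 hne) hn
    · obtain ⟨-, hne, hn⟩ := hM hmult
      exact padicRegulator_ne_zero_of_norm_eq Dh (lhs_ne_zero hϖ0 hne) hn
  · have hnev : ¬ Even (p / 2) := by rw [Nat.not_even_iff_odd]; exact ⟨p / 4, by omega⟩
    have hC' : C • V.quadraticTwist (-(p : ℚ)) = W := by
      rw [pStar_eq_of_mod_four p (Or.inr h3), if_neg (by omega)] at hC; exact hC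
    rw [if_neg hnev] at hϖ
    obtain ⟨hG, hM⟩ := hodd h3 hC' ϖ hϖ
    rcases hV with hord | hmult
    · obtain ⟨-, hne, hn⟩ := hG hord
      exact padicRegulator_ne_zero_of_norm_eq Dh (lhs_ne_zero hϖ0 hne) hn
    · obtain ⟨-, hne, hn⟩ := hM hmult
      exact padicRegulator_ne_zero_of_norm_eq Dh (lhs_ne_zero hϖ0 hne) hn

/-- **(G-ord, `e = 2`) rows: valuation relation for `Dh` ⟹ `SchneiderConjecture Dh`** (the good
ordinary twist model, its newform and the period ratio are kernel theorems). [cite: Schneider1982PadicHeightI, §1]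
[cite: MazurTateTeitelbaum1986Invent, §I.13] -/
theorem schneider_of_valRelationAt (hGZ : GrossZagier1986_thm_I_7_3)
    (hGZK : rank_eq_analyticRank_of_analyticRank_le_one)
    (hmodD : nonempty_modularParametrizationData) {W : WeierstrassCurve ℚ} [W.IsElliptic]
    [W.IsGloballyMinimal] (hp2 : p ≠ 2) (hG : TypeGOrd W p) (hadd : Addv W p)
    (he : semistabilityIndex W p = 2) (hr : W.analyticRank = 1)
    {Dh : PAdicHeightData W p} (hrel : ValRelationAt W p Dh) : SchneiderConjecture Dh := by
  obtain ⟨V, iV, iVm, C, hV, hC⟩ := TypeGOrd.exists_goodOrd_pStar_twist_model W p hp2 hG hadd he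
  haveI : NeZero (V.conductorNorm ℤ) := ⟨(V.conductorNorm_pos_holds).ne'⟩
  obtain ⟨Dm⟩ := hmodD V
  obtain ⟨ϖ, hϖ⟩ := exists_periodRatio_parity (p := p) V Dm
  exact schneider_of_valRelationAt_of_twist_model hGZ hGZK hp2 hadd hr V C hC (Or.inl hV)
    Dm.isNewformOf ϖ hϖ hrel

/-- **(M) rows: valuation relation for `Dh` ⟹ `SchneiderConjecture Dh`** (`AdditivePotMult.PotMult W p`).
[cite: Schneider1982PadicHeightI, §1] [cite: MazurTateTeitelbaum1986Invent, §I.10, §I.13] -/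
theorem schneider_of_valRelationAt_mult (hGZ : GrossZagier1986_thm_I_7_3)
    (hGZK : rank_eq_analyticRank_of_analyticRank_le_one)
    (hmodD : nonempty_modularParametrizationData) {W : WeierstrassCurve ℚ} [W.IsElliptic]
    [W.IsGloballyMinimal] (hp2 : p ≠ 2) (hpm : AdditivePotMult.PotMult W p) (hr : W.analyticRank = 1)
    {Dh : PAdicHeightData W p} (hrel : ValRelationAt W p Dh) : SchneiderConjecture Dh := by
  obtain ⟨V, iV, iVm, C, hV, hC⟩ := hpm.exists_mult_pStar_twist_model hp2
  haveI : NeZero (V.conductorNorm ℤ) := ⟨(V.conductorNorm_pos_holds).ne'⟩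
  obtain ⟨Dm⟩ := hmodD V
  obtain ⟨ϖ, hϖ⟩ := exists_periodRatio_parity (p := p) V Dm
  exact schneider_of_valRelationAt_of_twist_model hGZ hGZK hp2 hpm.1 hr V C hC (Or.inr hV)
    Dm.isNewformOf ϖ hϖ hrel

end CensusX42

end Summit.BirchSwinnertonDyer.Rank1Residual.Additive

end
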